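import Literature.Algebra.Homology.FreeAbelianCohomologyExteriorAlgebra
import Literature.LinearAlgebra.Alternating.ExteriorAlgebraOddSquare
import HarnessLib

/-!
# `H*(ℤ^d, k)` is ALTERNATING for every commutative ring `k`: `u ∪ u = 0` in every odd degree
# (Brown V §6 Thm. 6.4 (ii) + Bourbaki A III §7 no. 3 Cor. 2)

Topic `Algebra/Homology`; namespace `Literature.Algebra.Homology`.  Lane `lit-hodgefound` (Track 2,
Layer A), seat p30 gen 8, row g8-#5 (group-cohomology half); theorems only, NO definition, NO named
fact, no `sorry`.

For an ARBITRARY group `G` the cup product on `H*(G, k)` is only anti-commutative (Brown V (3.6), the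
tree's `cupProduct_comm` / `cohomologyRing_of_mul_of_comm`), so an odd-degree class satisfies
`2 (u ∪ u) = 0` (`cupProduct_self_add_self_of_odd`) and no more — `H*(ℤ/2, 𝔽₂) = 𝔽₂[x]` with
`deg x = 1`, `x² ≠ 0`.  For a free abelian group of finite rank the ring IS alternating in Bourbaki's
sense (A III §4 no. 9 Def. 7: anticommutative AND `x² = 0` for homogeneous `x` of odd degree), with no
hypothesis on `2 ∈ k`:

* K. S. Brown, *Cohomology of Groups*, GTM 87 (1982), V §6 **Theorem 6.4 (ii)** (p. 129 of the held
  text `book:brown1982-cohomology-groups`, p0129 L7–L13): for `G` free abelian of finite rank and any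
  commutative `k` (trivial action) the map `ψ : ⋀_k(H¹(G, k)) → H*(G, k)` of (6.1) is a `k`-algebra
  isomorphism — the tree's `exteriorAlgebraEquivCohomology` / `exteriorPowerEquivCohomology`
  (`FreeAbelianCohomologyExteriorAlgebra.lean`);
* N. Bourbaki, *Algebra I*, Ch. III §7 no. 3 **Corollary 2** to Prop. 5 (p0611 L25 of
  `book:bourbakind-algebra`): "The graded algebra `⋀(M)` is alternating" — the tree's
  `mul_comm_of_mem_exteriorPower` (anticommutative half) and
  `Literature.LinearAlgebra.Alternating.mul_self_eq_zero_of_mem_exteriorPower_odd` (odd squares,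
  `ExteriorAlgebraOddSquare.lean`).

Transporting the second along the first: `ψ` is multiplicative and maps `⋀ⁿ` onto `Hⁿ`
(`exteriorToCohomology_coe`, `wedgeToCohomology_surjective`), and `ιₙ(u) · ιₙ(u) = ι₂ₙ(u ∪ u)` in
`H*(G, k) = ⨁ₙ Hⁿ` (`cohomologyRing_of_mul_of`).

## What this file proves

* `cupProduct_wedgeToCohomology_self_eq_zero_of_odd` — for ANY group `G` and any `k` with
  `u ∪ u = 0` on `H¹(G, k)` (the hypothesis `hsq` under which Brown's `ψ` exists): every class in the
  image `ψ(⋀ⁿ H¹) ⊆ Hⁿ(G, k)`, `n` odd, has `u ∪ u = 0`;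
* **`cupProduct_self_eq_zero_of_odd_of_basis`** — `G` commutative with a `ℤ`-basis `b : Fin d → G`,
  any commutative `k`, `n` odd, `u ∈ Hⁿ(G, k)`: **`u ∪ u = 0`** (along any `n + n = m`; compare the
  tree's general-group `cupProduct_self_eq_zero_of_odd`, which needs `IsUnit (2 : k)`); ring form
  `cohomologyRing_of_mul_self_of_odd_of_basis` (`ιₙ(u)² = 0` in `H*(G, k)`);
* lattice forms `cupProduct_self_eq_zero_lattice_of_odd`, `cohomologyRing_of_mul_self_lattice_of_odd`
  for `Λ = ℤ^ι`, `ι` finite (the period lattice of a complex torus: `Hⁿ(Λ, ℤ) = Hⁿ(X, ℤ)`).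

## References

* K. S. Brown, *Cohomology of Groups*, GTM 87, Springer (1982), V §6 (6.1), Thm. 6.4.
  [Brown1982CohomologyGroups]
* N. Bourbaki, *Algebra I, Chapters 1–3*, Springer (1989), Ch. III §4 no. 9 Def. 7; §7 no. 3 Cor. 2
  to Prop. 5. [BourbakiAlgebraI1989]
-/

noncomputable section

open CategoryTheory groupCohomology DirectSum

universe u

namespace Literature.Algebra.Homology

variable {k G : Type u} [CommRing k] [Group G]

/-! ### §1 Any group: odd-degree classes in the image of `ψ` square to zero -/

section Psi

variable (hsq : ∀ u : cohomologyGrade k G 1, cupProduct (rfl : 1 + 1 = 2) u u = 0)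

/-- **Odd-degree classes in the image of Brown's `ψ` square to zero**: if `u ∪ u = 0` on `H¹(G, k)`
(so that `ψ : ⋀_k H¹ → H*(G, k)` is defined), then for `n` odd and `x ∈ ⋀ⁿ H¹(G, k)`,
`ψₙ(x) ∪ ψₙ(x) = 0` — because `x ∧ x = 0` in the alternating algebra `⋀(H¹)` and `ψ` is a ring map.
[cite: Brown1982CohomologyGroups, V §6 (6.1); BourbakiAlgebraI1989, Ch. III §7 no. 3 Cor. 2 to Prop. 5] -/
theorem cupProduct_wedgeToCohomology_self_eq_zero_of_odd {n m : ℕ} (hnm : n + n = m) (hn : Odd n)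
    (x : ⋀[k]^n (cohomologyGrade k G 1)) :
    cupProduct hnm (wedgeToCohomology hsq n x) (wedgeToCohomology hsq n x) = 0 := by
  subst hnm
  have h := congrArg (exteriorToCohomology hsq)
    (Literature.LinearAlgebra.Alternating.exteriorPower_coe_mul_self_eq_zero_of_odd k hn x)
  rw [map_mul, map_zero, exteriorToCohomology_coe, cohomologyRing_of_mul_of,
    ← (DirectSum.of (cohomologyGrade k G) (n + n)).map_zero] at h
  exact DirectSum.of_injective (n + n) h

end Psi

/-! ### §2 Free abelian groups of finite rank: `H*(G, k)` is alternating -/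

section FreeAbelian

variable {G : Type u} [CommGroup G] {d : ℕ} (b : Fin d → G)
  (hgen : ∀ g : G, ∃ m : Fin d → ℤ, g = ∏ l, b l ^ m l)
  (hind : ∀ m : Fin d → ℤ, ∏ l, b l ^ m l = 1 → m = 0)

include hgen hind in
/-- **`u ∪ u = 0` for every class of ODD degree in `H*(G, k)`, `G` free abelian of finite rank, `k`
any commutative ring** (no hypothesis on `2`): `H*(G, k) ≅ ⋀_k(H¹)` as `k`-algebras (Brown (6.4)(ii))
and `⋀` is alternating (Bourbaki's Cor. 2).  For a general group only `2 (u ∪ u) = 0` holds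
(`cupProduct_self_add_self_of_odd`; the tree's `cupProduct_self_eq_zero_of_odd` needs `IsUnit (2 : k)`).
[cite: Brown1982CohomologyGroups, V §6 Thm. 6.4; BourbakiAlgebraI1989, Ch. III §7 no. 3 Cor. 2 to Prop. 5, §4 no. 9 Def. 7] -/
theorem cupProduct_self_eq_zero_of_odd_of_basis {n m : ℕ} (hnm : n + n = m) (hn : Odd n)
    (u : cohomologyGrade k G n) : cupProduct hnm u u = 0 := by
  obtain ⟨x, rfl⟩ := wedgeToCohomology_surjective (k := k) b hgen hind n u
  exact cupProduct_wedgeToCohomology_self_eq_zero_of_odd _ hnm hn x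

include hgen hind in
/-- Ring form: **`H*(G, k) = ⨁ₙ Hⁿ(G, k)` is an alternating graded algebra** — `ιₙ(u) · ιₙ(u) = 0`
for `n` odd (`G` free abelian of finite rank, any commutative `k`).
[cite: Brown1982CohomologyGroups, V §6 Thm. 6.4; BourbakiAlgebraI1989, Ch. III §4 no. 9 Def. 7, §7 no. 3 Cor. 2 to Prop. 5] -/
theorem cohomologyRing_of_mul_self_of_odd_of_basis {n : ℕ} (hn : Odd n) (u : cohomologyGrade k G n) :
    DirectSum.of (cohomologyGrade k G) n u * DirectSum.of (cohomologyGrade k G) n u = 0 := by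
  rw [cohomologyRing_of_mul_of, cupProduct_self_eq_zero_of_odd_of_basis b hgen hind rfl hn u, map_zero]

end FreeAbelian

/-! ### §3 The lattice `Λ = ℤ^ι` -/

section Lattice

variable (ι : Type) [Fintype ι] (k : Type) [CommRing k]

/-- **`u ∪ u = 0` in every odd degree of `H*(ℤ^ι, k)`**, `ι` finite, `k` any commutative ring.
[cite: Brown1982CohomologyGroups, V §6 Thm. 6.4; BourbakiAlgebraI1989, Ch. III §7 no. 3 Cor. 2 to Prop. 5] -/
theorem cupProduct_self_eq_zero_lattice_of_odd {n m : ℕ} (hnm : n + n = m) (hn : Odd n)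
    (u : cohomologyGrade k (Multiplicative (ι → ℤ)) n) : cupProduct hnm u u = 0 := by
  classical
  exact cupProduct_self_eq_zero_of_odd_of_basis (piZBasis (Fintype.equivFin ι).symm) (piZBasis_gen _)
    (piZBasis_ind _) hnm hn u

/-- Ring form for the lattice: `ιₙ(u)² = 0` in `H*(ℤ^ι, k)` for `n` odd.
[cite: Brown1982CohomologyGroups, V §6 Thm. 6.4; BourbakiAlgebraI1989, Ch. III §4 no. 9 Def. 7] -/
theorem cohomologyRing_of_mul_self_lattice_of_odd {n : ℕ} (hn : Odd n)
    (u : cohomologyGrade k (Multiplicative (ι → ℤ)) n) :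
    DirectSum.of (cohomologyGrade k (Multiplicative (ι → ℤ))) n u *
      DirectSum.of (cohomologyGrade k (Multiplicative (ι → ℤ))) n u = 0 := by
  rw [cohomologyRing_of_mul_of, cupProduct_self_eq_zero_lattice_of_odd ι k rfl hn u, map_zero]

end Lattice

end Literature.Algebra.Homology

end
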